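import Mathlib
import Summits.Ventures.HodgeRepro2.HolomorphicFiniteDimensional
import Summits.Ventures.HodgeRepro2.HeckeFiniteIndex
import Summits.Ventures.HodgeRepro2.NonVanishingHeckeEigenform

/-!
# HeckeEigenformsUnconditional — the Hecke-eigenform statements with the finite-dimensionality
hypothesis discharged

Blind cell `pub-hodge-repro2`, seat p2 (Tier 5 kernel support).

`HolomorphicFiniteDimensional.lean` proved that the holomorphic part of the Petersson space of a
compact quotient `S\𝔹²` is finite-dimensional (for `S` acting properly discontinuously — which is
`LevelDiscrete`'s `properlyDiscontinuousSMul_frameAction` for every congruence subgroup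
`S ⊆ Γ_N`). This file restates the Hecke-eigenform theorems of `HeckeFiniteIndex.lean` and
`NonVanishingHeckeEigenform.lean` WITHOUT the `[FiniteDimensional …]` hypothesis: on the Hecke side
the only remaining prose inputs are the commutativity of the Hecke operators of the family and
the compactness of `Γ_1\𝔹²` (anisotropy).
-/

namespace Summit.Ventures.HodgeRepro2.ShimuraData

open MeasureTheory JointEigenbasis

variable {K : Type*} [Field K] [NumberField K] [NumberField.IsCMField K] {τ₁ : K →+* ℂ}
  {H : Matrix (Fin 3) (Fin 3) K} {Q : Matrix (Fin 3) (Fin 3) ℂ} {𝔪 : Submodule ℤ (Fin 3 → K)}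

/-- **Simultaneous Hecke eigenforms in the holomorphic forms of a congruence subgroup, with no
finite-dimensionality hypothesis.** For `S ⊆ Γ_N` of finite index in `Γ_1` (hermitian `H`,
definite away from `τ₁`, lattice `𝔪`), `S\𝔹²` compact, a measurable fundamental domain `D`, and an
inversion-closed family of rational unitary matrices whose Hecke operators commute pairwise, the
holomorphic part of the Petersson space of weight `k` has an orthonormal basis of simultaneous
Hecke eigenforms. -/
theorem exists_orthonormalBasis_heckeSpace_holomorphic_unconditional (hH : IsHermitianForm K H)
    (hdef : ∀ τ : K →+* ℂ, NumberField.InfinitePlace.mk τ ≠ NumberField.InfinitePlace.mk τ₁ →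
      IsDefiniteAt K τ H)
    (hQ : IsFrame K τ₁ H Q) (h𝔪 : IsLattice K 𝔪) {N : ℕ} {S : Subgroup (GL (Fin 3) K)}
    (hS : (S : Set (GL (Fin 3) K)) ⊆ shimuraLevel K H 𝔪 N)
    (hS₁ : S ≤ shimuraLevelSubgroup K H 𝔪 1)
    (hfin : (S.subgroupOf (shimuraLevelSubgroup K H 𝔪 1)).FiniteIndex)
    [CompactSpace (ballQuotient hQ S (subset_unitaryGroup_of_subset_shimuraLevel hS))]
    {D : Set ball₂} (k : ℕ)
    (hD : IsBallFundamentalDomain hQ S (subset_unitaryGroup_of_subset_shimuraLevel hS) D)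
    (hDm : MeasurableSet D) {ι : Type*} (δ : ι → unitaryGroup K H) (σ : ι → ι)
    (hσ : ∀ i, δ (σ i) = (δ i)⁻¹)
    (hcomm : ∀ i j, Commute
      (heckeFamilyOf hQ S _ k hD hDm (fun δ => fintypeHeckeQuotientOfFiniteIndex h𝔪 hS₁ hfin δ.2) (δ i))
      (heckeFamilyOf hQ S _ k hD hDm (fun δ => fintypeHeckeQuotientOfFiniteIndex h𝔪 hS₁ hfin δ.2) (δ j))) :
    ∃ b : OrthonormalBasis (Fin (Module.finrank ℂ (holomorphicSpace hQ S _ k hD))) ℂ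
        (holomorphicSpace hQ S _ k hD), ∀ a i, ∃ μ : ℂ,
      heckeFamilyOf hQ S _ k hD hDm (fun δ => fintypeHeckeQuotientOfFiniteIndex h𝔪 hS₁ hfin δ.2)
        (δ i) (b a) = μ • (b a : PeterssonSpace hQ S _ k hD) := by
  haveI : FiniteDimensional ℂ (holomorphicSpace hQ S (subset_unitaryGroup_of_subset_shimuraLevel hS) k hD) :=
    finiteDimensional_holomorphicSpace hQ S _ k hD
      (properlyDiscontinuousSMul_frameAction hH hdef hQ h𝔪 hS)
  exact exists_orthonormalBasis_heckeSpace_holomorphic_of_finiteIndex hQ S _ k hD hDm h𝔪 hS₁ hfin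
    δ σ hσ hcomm

/-- **The Tier-3 input produces a simultaneous Hecke eigenform — with no finite-dimensionality
hypothesis.** As `NonVanishingInput.exists_hecke_eigenform`, but the finite-dimensionality of the
holomorphic part is now proved, so only the commutativity of the Hecke operators of the family
remains as a hypothesis. -/
theorem NonVanishingInput.exists_hecke_eigenform_unconditional (hH : IsHermitianForm K H)
    (hdef : ∀ τ : K →+* ℂ, NumberField.InfinitePlace.mk τ ≠ NumberField.InfinitePlace.mk τ₁ →
      IsDefiniteAt K τ H)
    (hQ : IsFrame K τ₁ H Q) (h𝔪 : IsLattice K 𝔪) (hnv : NonVanishingInput K τ₁ H 𝔪 Q) {N : ℕ}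
    (hN : 2 < N)
    [CompactSpace (ballQuotient hQ (shimuraLevelSubgroup K H 𝔪 1)
      (shimuraLevelSubgroup_one_subset_unitaryGroup H 𝔪))] :
    ∃ S' : Subgroup (GL (Fin 3) K), ∃ hS' : (S' : Set (GL (Fin 3) K)) ⊆ shimuraLevel K H 𝔪 N,
      IsTorsionFreeSet K (S' : Set (GL (Fin 3) K)) ∧
      ∃ hS₁ : S' ≤ shimuraLevelSubgroup K H 𝔪 1,
      ∃ hfin : (S'.subgroupOf (shimuraLevelSubgroup K H 𝔪 1)).FiniteIndex,
      ∃ _hc : CompactSpace (ballQuotient hQ S' (subset_unitaryGroup_of_subset_shimuraLevel hS')),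
      ∃ D : Set ball₂, ∃ hDm : MeasurableSet D,
      ∃ hD : IsBallFundamentalDomain hQ S' (subset_unitaryGroup_of_subset_shimuraLevel hS') D,
      ∃ f : PeterssonForms hQ S' (subset_unitaryGroup_of_subset_shimuraLevel hS') 3 hD,
        f ∈ holomorphicForms hQ S' _ 3 hD ∧
        (SeparationQuotient.mk f : PeterssonSpace hQ S' _ 3 hD) ≠ 0 ∧
        ∀ (ι : Type) (δ : ι → unitaryGroup K H) (σ : ι → ι), (∀ i, δ (σ i) = (δ i)⁻¹) →
          (∀ i j, Commute
            (heckeFamilyOf hQ S' _ 3 hD hDm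
              (fun δ => fintypeHeckeQuotientOfFiniteIndex h𝔪 hS₁ hfin δ.2) (δ i))
            (heckeFamilyOf hQ S' _ 3 hD hDm
              (fun δ => fintypeHeckeQuotientOfFiniteIndex h𝔪 hS₁ hfin δ.2) (δ j))) →
          ∃ v : PeterssonSpace hQ S' _ 3 hD, v ∈ holomorphicSpace hQ S' _ 3 hD ∧ ‖v‖ = 1 ∧
            (∀ i, ∃ μ : ℂ, heckeFamilyOf hQ S' _ 3 hD hDm
              (fun δ => fintypeHeckeQuotientOfFiniteIndex h𝔪 hS₁ hfin δ.2) (δ i) v = μ • v) ∧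
            inner ℂ v (SeparationQuotient.mk f : PeterssonSpace hQ S' _ 3 hD) ≠ 0 := by
  obtain ⟨S', hS', htf, hS₁, hfin, hc, D, hDm, hD, f, hfhol, hfne, hmain⟩ :=
    hnv.exists_hecke_eigenform hH hdef hQ h𝔪 hN
  refine ⟨S', hS', htf, hS₁, hfin, hc, D, hDm, hD, f, hfhol, hfne, ?_⟩
  intro ι δ σ hσ hcomm
  haveI := hc
  haveI : FiniteDimensional ℂ (holomorphicSpace hQ S' (subset_unitaryGroup_of_subset_shimuraLevel hS') 3 hD) :=
    finiteDimensional_holomorphicSpace hQ S' _ 3 hD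
      (properlyDiscontinuousSMul_frameAction hH hdef hQ h𝔪 hS')
  exact hmain ι δ σ hσ hcomm inferInstance

/-- **Eigenforms of a single self-adjoint Hecke operator, unconditionally.** If `T_δ = T_{δ⁻¹}` on
the Petersson space (e.g. when the double cosets `SδS` and `Sδ⁻¹S` coincide), then the holomorphic
part of the Petersson space of a congruence subgroup with compact quotient has an orthonormal basis
of `T_δ`-eigenforms — no commutation hypothesis is needed for a single operator. -/
theorem exists_orthonormalBasis_heckeSpace_holomorphic_of_self_adjoint (hH : IsHermitianForm K H)
    (hdef : ∀ τ : K →+* ℂ, NumberField.InfinitePlace.mk τ ≠ NumberField.InfinitePlace.mk τ₁ →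
      IsDefiniteAt K τ H)
    (hQ : IsFrame K τ₁ H Q) (h𝔪 : IsLattice K 𝔪) {N : ℕ} {S : Subgroup (GL (Fin 3) K)}
    (hS : (S : Set (GL (Fin 3) K)) ⊆ shimuraLevel K H 𝔪 N)
    (hS₁ : S ≤ shimuraLevelSubgroup K H 𝔪 1)
    (hfin : (S.subgroupOf (shimuraLevelSubgroup K H 𝔪 1)).FiniteIndex)
    [CompactSpace (ballQuotient hQ S (subset_unitaryGroup_of_subset_shimuraLevel hS))]
    {D : Set ball₂} (k : ℕ)
    (hD : IsBallFundamentalDomain hQ S (subset_unitaryGroup_of_subset_shimuraLevel hS) D)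
    (hDm : MeasurableSet D) (δ : unitaryGroup K H)
    (hself : heckeFamilyOf hQ S _ k hD hDm (fun δ => fintypeHeckeQuotientOfFiniteIndex h𝔪 hS₁ hfin δ.2) δ
      = heckeFamilyOf hQ S _ k hD hDm (fun δ => fintypeHeckeQuotientOfFiniteIndex h𝔪 hS₁ hfin δ.2) δ⁻¹) :
    ∃ b : OrthonormalBasis (Fin (Module.finrank ℂ (holomorphicSpace hQ S _ k hD))) ℂ
        (holomorphicSpace hQ S _ k hD), ∀ a, ∃ μ : ℂ,
      heckeFamilyOf hQ S _ k hD hDm (fun δ => fintypeHeckeQuotientOfFiniteIndex h𝔪 hS₁ hfin δ.2)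
        δ (b a) = μ • (b a : PeterssonSpace hQ S _ k hD) := by
  haveI : FiniteDimensional ℂ (holomorphicSpace hQ S (subset_unitaryGroup_of_subset_shimuraLevel hS) k hD) :=
    finiteDimensional_holomorphicSpace hQ S _ k hD
      (properlyDiscontinuousSMul_frameAction hH hdef hQ h𝔪 hS)
  -- the one-element family `Unit → U(H)(K)` with `σ = id`: the formal adjoint of `T_δ` is itself
  set T := heckeFamilyOf hQ S (subset_unitaryGroup_of_subset_shimuraLevel hS) k hD hDm
    (fun δ => fintypeHeckeQuotientOfFiniteIndex h𝔪 hS₁ hfin δ.2) with hTdef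
  have hadj : IsFormalAdjointPair (T δ) (T δ) := by
    have := isFormalAdjointPair_heckeFamilyOf hQ S (subset_unitaryGroup_of_subset_shimuraLevel hS)
      k hD hDm (fun δ => fintypeHeckeQuotientOfFiniteIndex h𝔪 hS₁ hfin δ.2) δ
    rw [← hTdef, ← hself] at this
    exact this
  obtain ⟨b, hb⟩ := exists_orthonormalBasis_of_isFormalAdjointPair_of_commute_restrict
    (fun _ : Unit => T δ) id (fun _ => hadj) (fun _ _ => Commute.refl _)
    (holomorphicSpace hQ S _ k hD)
    (fun _ => heckeFamilyOf_mem_holomorphicSpace hQ S _ k hD hDm _ δ)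
  exact ⟨b, fun a => hb a ()⟩

end Summit.Ventures.HodgeRepro2.ShimuraData
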